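import Summits.NavierStokesRegularity.FunctionalMining.StretchingHolderBound
import Literature.Analysis.FluidPDE.MillerStrainDeterminantBound
import Literature.Analysis.FluidPDE.TorusGradientVorticityLp
import HarnessLib

/-!
(Part 1/3 of the no-go seat's staged `StretchingSupNotSharp` — split by the prove seat for the 400-line cap; this part: pointwise Hölder-with-deficit algebra, `strainNormSqAt`, `StrainL4Bound`, the pointwise torus bounds.)
# Functional mining: Hölder's constant `2/√3` is NOT sharp — `StretchingSupSharp` fails (K1-Q1)

Search for candidate a priori estimates; no regularity claim.

Cell `pub-nsfunc`, no-go seat (gen 5), STAGED for the prove seat (target tree path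
`Summits/NavierStokesRegularity/FunctionalMining/NoGo/StretchingSupNotSharp.lean`). Paper write-up:
`HOME/pub-nsfunc-nogo/K1Q1.md` [ours, UNREVIEWED].

THEOREM (static, on `𝕋³`). If `K ≥ 0` is a constant with `∫|S|_F⁴ ≤ K ∫|ω|⁴` for all smooth
divergence-free `v` (`StrainL4Bound K`; such a `K` exists by the periodic Calderón–Zygmund
inequality, tree `BDSV.exists_eLpNorm_twoStrain_le_curl` at `p = 4`), then the static stretching
bound holds with a constant STRICTLY below Hölder's:
`StretchingSupBound (2/√3 − 1/(4√3(4K+1)))` (`stretchingSupBound_of_strainL4Bound`). Hence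
`StrainL4Bound K → ¬ StretchingSupSharp` (`not_stretchingSupSharp_of_strainL4Bound`), and — the `L⁴`
bound being a tree theorem on `T³` (`exists_strainL4Bound_fin3`, `K = (2187/16)·C₄⁴`) —
UNCONDITIONALLY `¬ StretchingSupSharp (d := Fin 3)` (`not_stretchingSupSharp_fin3`), equivalently
`∃ C < 2/√3, StretchingSupBound (d := Fin 3) C` (`exists_stretchingSupBound_lt_holder`). The
dictionary question K1-Q1 ("is Hölder's `2/√3` the optimal static constant?") is thereby DECIDED: no.
The improvement `δ = 1/(4√3(4K+1))` is not numerically explicit (the tree's Calderón–Zygmund constant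
`C₄` is existential); the optimal constant remains unknown (numerical evidence `≈ 0.25`, NOGO.md §1).

MECHANISM. (E1) Hölder with the Cauchy–Schwarz deficit: `σ ≤ (M/√3)(2ℰ − ½∫(√2|S| − |ω|)²)`
(pointwise `ωᵀSω ≤ M√(2/3)|S||ω| = (M/√3)(|S|² + ½|ω|² − ½(√2|S| − |ω|)²)`).
(E2) Betchov–Miller `σ = −4∫det S ≤ (2√6/9)∫|S|³` (tree `neg_integral_stretching_le_strain_cube`)
and `|S|³ ≤ ½M|S||ω| + …`, the remainder being `≤ (M/4t)(√2|S|−|ω|)² + (t/4M)(4|S|⁴ + 2|S|²|ω|²)`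
pointwise (Young), whose integral the `L⁴` bound controls: `σ ≤ (2√6/9)M[ℰ/√2 + Δ/(4t) + t(2K+½)ℰ]`,
`Δ = ∫(√2|S| − |ω|)²`. With `t = 1/(8K+2)`: if `Δ ≥ ℰ/(8K+2)` then (E1) gives the constant
`2/√3 − 1/(4√3(4K+1))`; otherwise (E2) gives `(2√6/9)(1/√2 + ½) ≈ 0.657`. No time, no solutions.
-/

noncomputable section

open Set MeasureTheory Finset
open scoped InnerProductSpace RealInnerProductSpace ENNReal NNReal

namespace Summit.NavierStokesRegularity.FunctionalMining

open Literature.Analysis.FunctionSpaces Literature.Analysis.FluidPDE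

/-! ## Pointwise algebra on `3 × 3` arrays: Hölder with the Cauchy–Schwarz deficit -/

namespace HolderStretching

/-- **Hölder's pointwise stretching bound WITH DEFICIT.** For a trace-free `3 × 3` array `G`, its
vorticity vector `w` with `|w|² ≤ M²` (`M ≥ 0`), strain square `x = |S|_F²` and `wsq = |w|²`:
`tr G³ − tr GGᵀG (= wᵀSw) ≤ (M/√3)·(x + ½wsq − ½(√2·√x − √wsq)²)` — i.e. `wᵀSw ≤ M√(2/3)√x√wsq`,
rewritten through the identity `√2√x√wsq = x + ½wsq − ½(√2√x − √wsq)²`. [folklore] -/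
theorem cubeTrace_sub_stretchCubic_le_deficit (G : Fin 3 → Fin 3 → ℝ) {M : ℝ} (hM : 0 ≤ M)
    (htr : ∑ i, G i i = 0) (w : Fin 3 → ℝ)
    (hw : w = ![G 2 1 - G 1 2, G 0 2 - G 2 0, G 1 0 - G 0 1]) (hω : ∑ i, w i ^ 2 ≤ M ^ 2) :
    (∑ i, ∑ j, ∑ k, G i j * G j k * G k i) - (∑ i, ∑ j, ∑ m, G i m * G j m * G j i) ≤
      M / Real.sqrt 3 * ((∑ i, ∑ j, ((G i j + G j i) / 2) ^ 2) + 2⁻¹ * ∑ i, w i ^ 2 -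
        2⁻¹ * (Real.sqrt 2 * Real.sqrt (∑ i, ∑ j, ((G i j + G j i) / 2) ^ 2) -
          Real.sqrt (∑ i, w i ^ 2)) ^ 2) := by
  set Q : ℝ := ∑ i, ∑ j, w i * ((G i j + G j i) / 2) * w j with hQ
  set x : ℝ := ∑ i, ∑ j, ((G i j + G j i) / 2) ^ 2 with hx
  set wsq : ℝ := ∑ i, w i ^ 2 with hwsq
  have hid : (∑ i, ∑ j, ∑ k, G i j * G j k * G k i) - (∑ i, ∑ j, ∑ m, G i m * G j m * G j i) =
      Q := by
    rw [DoeringGibbon1995.cubeTrace_sub_stretchCubic G w hw, htr, mul_zero, sub_zero]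
  have htrS : ∑ i, (G i i + G i i) / 2 = 0 := by
    rw [show (∑ i, (G i i + G i i) / 2) = ∑ i, G i i from
      Finset.sum_congr rfl fun i _ => by ring, htr]
  have hx0 : 0 ≤ x := Finset.sum_nonneg fun i _ => Finset.sum_nonneg fun j _ => sq_nonneg _
  have hw0 : 0 ≤ wsq := Finset.sum_nonneg fun i _ => sq_nonneg _
  have hs2 : 0 < Real.sqrt 2 := Real.sqrt_pos.2 (by norm_num)
  have hs3 : 0 < Real.sqrt 3 := Real.sqrt_pos.2 (by norm_num)
  have h2 : Real.sqrt 2 ^ 2 = 2 := Real.sq_sqrt (by norm_num)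
  have h3 : Real.sqrt 3 ^ 2 = 3 := Real.sq_sqrt (by norm_num)
  set p : ℝ := Real.sqrt x with hp
  set m : ℝ := Real.sqrt wsq with hm
  have hp0 : 0 ≤ p := Real.sqrt_nonneg _
  have hm0 : 0 ≤ m := Real.sqrt_nonneg _
  have hp2 : p ^ 2 = x := Real.sq_sqrt hx0
  have hm2 : m ^ 2 = wsq := Real.sq_sqrt hw0
  -- `Q² ≤ (2/3) x wsq² ≤ (2/3) x wsq M²`
  have hQ2 : Q ^ 2 ≤ 2 / 3 * x * wsq ^ 2 :=
    quadForm_sq_le_two_thirds (fun i j => (G i j + G j i) / 2) htrS w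
  have hQ2' : Q ^ 2 ≤ 2 / 3 * x * wsq * M ^ 2 := by
    calc Q ^ 2 ≤ 2 / 3 * x * wsq ^ 2 := hQ2
      _ = 2 / 3 * x * wsq * wsq := by ring
      _ ≤ 2 / 3 * x * wsq * M ^ 2 := mul_le_mul_of_nonneg_left hω (by positivity)
  -- `R = M √(2/3) p m ≥ 0` has `R² = (2/3) x wsq M²`
  set R : ℝ := M * Real.sqrt 2 / Real.sqrt 3 * p * m with hR
  have hR0 : 0 ≤ R := by positivity
  have hR2 : R ^ 2 = 2 / 3 * x * wsq * M ^ 2 := by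
    have : R ^ 2 = M ^ 2 * Real.sqrt 2 ^ 2 / Real.sqrt 3 ^ 2 * p ^ 2 * m ^ 2 := by
      rw [hR]; ring
    rw [this, h2, h3, hp2, hm2]; ring
  have hQR : Q ≤ R := (abs_le_of_sq_le_sq' (hQ2'.trans hR2.symm.le) hR0).2
  -- the identity `x + ½wsq − ½(√2 p − m)² = √2 p m`
  have key : x + 2⁻¹ * wsq - 2⁻¹ * (Real.sqrt 2 * p - m) ^ 2 = Real.sqrt 2 * p * m := by
    linear_combination (-(p ^ 2) / 2) * h2 - hp2 - (1 / 2 : ℝ) * hm2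
  have hfin : M / Real.sqrt 3 * (x + 2⁻¹ * wsq - 2⁻¹ * (Real.sqrt 2 * p - m) ^ 2) = R := by
    rw [key, hR]; ring
  rw [hid, hfin]
  exact hQR

/-- **The cubic remainder, pointwise (Young).** For reals `p, m ≥ 0` with `m ≤ M`, `0 < M`, and every
`t > 0`: `p³ ≤ (M/2)(p²/√2 + m²/(2√2)) + (M/(4t))(√2p − m)² + (t/(4M))(4p⁴ + 2p²m²)`
(`p³ = ½pm² + ½p(√2p − m)(√2p + m)`, `pm² ≤ Mpm`, AM–GM, and `2ab ≤ εa² + b²/ε`). [folklore] -/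
theorem cube_le_young {p m M t : ℝ} (hp : 0 ≤ p) (hm : 0 ≤ m) (hmM : m ≤ M) (hM : 0 < M)
    (ht : 0 < t) :
    p ^ 2 * p ≤ M / 2 * (p ^ 2 / Real.sqrt 2 + m ^ 2 / (2 * Real.sqrt 2)) +
      M / (4 * t) * (Real.sqrt 2 * p - m) ^ 2 + t / (4 * M) * (4 * (p ^ 2) ^ 2 + 2 * p ^ 2 * m ^ 2) := by
  have hs2 : 0 < Real.sqrt 2 := Real.sqrt_pos.2 (by norm_num)
  have h2 : Real.sqrt 2 ^ 2 = 2 := Real.sq_sqrt (by norm_num)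
  set s : ℝ := Real.sqrt 2 with hs
  -- split `p³ = ½ p m² + ½ A B` with `A = s p − m`, `B = p (s p + m) ≥ 0`
  set A : ℝ := s * p - m with hA
  set B : ℝ := p * (s * p + m) with hB
  have hB0 : 0 ≤ B := by positivity
  have hsplit : p ^ 2 * p = 2⁻¹ * (p * m ^ 2) + 2⁻¹ * (A * B) := by
    have : A * B = p * (s ^ 2 * p ^ 2 - m ^ 2) := by rw [hA, hB]; ring
    rw [this, h2]; ring
  -- (a) `p m² ≤ M p m ≤ M (p²/s + m²/(2s))`
  have ha1 : p * m ^ 2 ≤ M * (p * m) := by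
    have : p * m ^ 2 = m * (p * m) := by ring
    rw [this]
    exact mul_le_mul_of_nonneg_right hmM (mul_nonneg hp hm)
  have ha2 : p * m ≤ p ^ 2 / s + m ^ 2 / (2 * s) := by
    rw [div_add_div _ _ hs2.ne' (by positivity), le_div_iff₀ (by positivity)]
    nlinarith [sq_nonneg (s * p - m), h2, hs2, mul_nonneg hp hm]
  have ha : 2⁻¹ * (p * m ^ 2) ≤ M / 2 * (p ^ 2 / s + m ^ 2 / (2 * s)) := by
    have := mul_le_mul_of_nonneg_left ha2 hM.le
    nlinarith [ha1, this]
  -- (b) Young: `A B ≤ (ε/2) A² + B²/(2ε)` with `ε = M/t`, and `B² ≤ 4p⁴ + 2p²m²`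
  have hε : 0 < M / t := div_pos hM ht
  have hyoung : A * B ≤ (M / t) / 2 * A ^ 2 + B ^ 2 / (2 * (M / t)) := by
    set ε : ℝ := M / t with hεdef
    have hsq : 0 ≤ (ε * A - B) ^ 2 := sq_nonneg _
    have hkey : 2 * ε * (A * B) ≤ ε ^ 2 * A ^ 2 + B ^ 2 := by nlinarith [hsq]
    have hre : ε / 2 * A ^ 2 + B ^ 2 / (2 * ε) = (ε ^ 2 * A ^ 2 + B ^ 2) / (2 * ε) := by
      field_simp
    rw [hre, le_div_iff₀ (by positivity)]
    linarith [hkey]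
  have hB2 : B ^ 2 ≤ 4 * (p ^ 2) ^ 2 + 2 * p ^ 2 * m ^ 2 := by
    have : B ^ 2 = p ^ 2 * (s * p + m) ^ 2 := by rw [hB]; ring
    rw [this]
    have hsum : (s * p + m) ^ 2 ≤ 2 * (s * p) ^ 2 + 2 * m ^ 2 := by
      nlinarith [sq_nonneg (s * p - m)]
    calc p ^ 2 * (s * p + m) ^ 2 ≤ p ^ 2 * (2 * (s * p) ^ 2 + 2 * m ^ 2) :=
          mul_le_mul_of_nonneg_left hsum (sq_nonneg p)
      _ = 4 * (p ^ 2) ^ 2 + 2 * p ^ 2 * m ^ 2 := by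
          have : (s * p) ^ 2 = s ^ 2 * p ^ 2 := by ring
          rw [this, h2]; ring
  have hb : 2⁻¹ * (A * B) ≤ M / (4 * t) * A ^ 2 + t / (4 * M) * (4 * (p ^ 2) ^ 2 + 2 * p ^ 2 * m ^ 2) := by
    have h1 : 2⁻¹ * (A * B) ≤ 2⁻¹ * ((M / t) / 2 * A ^ 2 + B ^ 2 / (2 * (M / t))) :=
      mul_le_mul_of_nonneg_left hyoung (by norm_num)
    have h2' : B ^ 2 / (2 * (M / t)) ≤ (4 * (p ^ 2) ^ 2 + 2 * p ^ 2 * m ^ 2) / (2 * (M / t)) :=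
      div_le_div_of_nonneg_right hB2 (by positivity)
    have h3 : 2⁻¹ * ((M / t) / 2 * A ^ 2 + (4 * (p ^ 2) ^ 2 + 2 * p ^ 2 * m ^ 2) / (2 * (M / t))) =
        M / (4 * t) * A ^ 2 + t / (4 * M) * (4 * (p ^ 2) ^ 2 + 2 * p ^ 2 * m ^ 2) := by
      field_simp
      ring
    linarith [h1, h2', h3.le, h3.ge]
  rw [hsplit]
  linarith [ha, hb]

end HolderStretching

/-! ## The `L⁴` Calderón–Zygmund input and the pointwise bounds on the torus -/

variable {d : Type*} [Fintype d] [DecidableEq d]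

/-- The Frobenius square of the strain at a point: `|S(x)|_F² = ∑ᵢⱼ (½((∂ⱼv)ᵢ + (∂ᵢv)ⱼ))²`
(the integrand of `integral_strainNormSq_eq_torusEnstrophy`: `∫|S|² = ℰ`). -/
def strainNormSqAt (v : UnitAddTorus d → EuclideanSpace ℝ d) (x : UnitAddTorus d) : ℝ :=
  ∑ i, ∑ j, ((Torus.partialDeriv j v x i + Torus.partialDeriv i v x j) / 2) ^ 2

/-- `|S(x)|² ≥ 0`. [folklore] -/
theorem strainNormSqAt_nonneg (v : UnitAddTorus d → EuclideanSpace ℝ d) (x : UnitAddTorus d) :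
    0 ≤ strainNormSqAt v x :=
  Finset.sum_nonneg fun _ _ => Finset.sum_nonneg fun _ _ => sq_nonneg _

/-- **The `L⁴` Calderón–Zygmund bound for the strain by the vorticity, in integral form, with
constant `K`**: `∫|S|_F⁴ ≤ K ∫|ω|⁴` for every smooth divergence-free field on the 3-torus. TRUE for
some finite `K` (periodic Calderón–Zygmund; tree `BDSV.exists_eLpNorm_twoStrain_le_curl` at
`p = 4`, Majda–Bertozzi 2002 (11.9)); used here as a hypothesis with the constant displayed.
Search for candidate a priori estimates; no regularity claim — nothing is asserted. -/
def StrainL4Bound (K : ℝ) : Prop :=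
  Fintype.card d = 3 → ∀ v : UnitAddTorus d → EuclideanSpace ℝ d,
    Torus.IsSmooth v → Torus.IsDivFree v →
      ∫ x, strainNormSqAt v x ^ 2 ≤ K * ∫ x, torusVorticitySqAt v x ^ 2

/-- **Pointwise, on the torus: Hölder with deficit.** For smooth divergence-free `v` on `T³` with
`|ω(x)|² ≤ M²`: `tr G³ − tr GGᵀG ≤ (M/√3)(|S|² + ½|ω|² − ½(√2|S| − |ω|)²)` at `x`. [folklore] -/
theorem sum_partialDeriv_cube_sub_stretch_le_deficit (hd : Fintype.card d = 3)
    {v : UnitAddTorus d → EuclideanSpace ℝ d} (hv : Torus.IsSmooth v) (hdiv : Torus.IsDivFree v)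
    {M : ℝ} (hM : 0 ≤ M) (x : UnitAddTorus d) (hω : torusVorticitySqAt v x ≤ M ^ 2) :
    (∑ i, ∑ j, ∑ k, Torus.partialDeriv j v x i * Torus.partialDeriv k v x j *
        Torus.partialDeriv i v x k) -
      (∑ m, ∑ i, Torus.partialDeriv m v x i *
        ⟪Torus.partialDeriv m v x, Torus.partialDeriv i v x⟫_ℝ) ≤
      M / Real.sqrt 3 * (strainNormSqAt v x + 2⁻¹ * torusVorticitySqAt v x -
        2⁻¹ * (Real.sqrt 2 * Real.sqrt (strainNormSqAt v x) -
          Real.sqrt (torusVorticitySqAt v x)) ^ 2) := by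
  set e : d ≃ Fin 3 := Fintype.equivFinOfCardEq hd with he
  set R : d → EuclideanSpace ℝ d := fun m => Torus.partialDeriv m v x with hR
  set G : Fin 3 → Fin 3 → ℝ := fun a b => R (e.symm b) (e.symm a) with hG
  have hre : ∀ F : d → ℝ, ∑ i, F i = ∑ a : Fin 3, F (e.symm a) := fun F =>
    Fintype.sum_equiv e _ _ fun i => by simp
  -- (i) the cubic trace
  have hB : ∑ i, ∑ j, ∑ k, R j i * R k j * R i k = ∑ a, ∑ b, ∑ c, G a b * G b c * G c a := by
    simp only [hG]
    simp_rw [hre]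
  -- (ii) the stretching cubic
  have hC : ∑ m, ∑ i, R m i * ⟪R m, R i⟫_ℝ = ∑ a, ∑ b, ∑ c, G a c * G b c * G b a := by
    have h1 : ∑ m, ∑ i, R m i * ⟪R m, R i⟫_ℝ = ∑ i, ∑ j, ∑ m, R m i * R m j * R i j := by
      have hinner : ∀ m i, R m i * ⟪R m, R i⟫_ℝ = ∑ j, R m i * R m j * R i j := by
        intro m i
        rw [show ⟪R m, R i⟫_ℝ = ∑ j, R m j * R i j from by simp [PiLp.inner_apply, mul_comm],
          Finset.mul_sum]
        exact Finset.sum_congr rfl fun j _ => by ring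
      simp_rw [hinner]
      rw [Finset.sum_comm]
      exact Finset.sum_congr rfl fun i _ => Finset.sum_comm
    rw [h1]
    simp only [hG]
    simp_rw [hre]
  -- (iii) the trace is the divergence
  have htr : ∑ a, G a a = 0 := by
    have h1 : ∑ a, G a a = ∑ m, R m m := by
      simp only [hG]; rw [hre]
    rw [h1, hR]
    have h2 := Torus.divergence_eq_sum_partialDeriv_apply (hv.isContDiff (by simp)) x
    rw [← h2]
    exact hdiv x
  -- (iv) the vorticity
  set w : Fin 3 → ℝ := ![G 2 1 - G 1 2, G 0 2 - G 2 0, G 1 0 - G 0 1] with hw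
  have hvort : ∑ a, w a ^ 2 = torusVorticitySqAt v x := by
    rw [DoeringGibbon1995.sum_vort_sq G w hw, torusVorticitySqAt]
    congr 1
    simp only [hG, hR]
    simp_rw [hre]
    rw [Finset.sum_comm]
  -- (v) the strain norm
  have hstrain : ∑ a, ∑ b, ((G a b + G b a) / 2) ^ 2 = ∑ i, ∑ j, ((R j i + R i j) / 2) ^ 2 := by
    simp only [hG]
    simp_rw [hre]
  have hX : strainNormSqAt v x = ∑ i, ∑ j, ((R j i + R i j) / 2) ^ 2 := by
    simp only [strainNormSqAt, hR]
  have key := HolderStretching.cubeTrace_sub_stretchCubic_le_deficit G hM htr w hw (hvort ▸ hω)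
  rw [hX, hB, hC, ← hstrain, ← hvort]
  exact key

end Summit.NavierStokesRegularity.FunctionalMining

end
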